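import Summits.CriticalPhenomena.SAWScalingLimit.Theorems.SAWDevelopingMapObservableToSLERestrictionCocycleHelpersLattice
import Literature.Probability.RandomPlanarGeometry.PlanarDomains
import HarnessLib

/-!
# Crux `SAWDevelopingMap.ObservableToSLE` (stmt-CriticalPhenomena-10472), line
`floor-ratio-restriction-bootstrap`: the lattice floor data of the mechanism stub
`stub_restrictionCocycle`

Landing target:
`Summits/CriticalPhenomena/SAWScalingLimit/Theorems/SAWDevelopingMapObservableToSLERestrictionCocycleHelpersFloor.lean`
(`--supports stmt-CriticalPhenomena-10472`).

For the two nested admissible families `Λ' δ ⊆ Λ δ` of the mechanism stub (exact half-lattice rows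
`≥ m δ` in the balls `B(a, ρ)`, `B(b, ρ)`, `Λ δ` above its floor row, `δ·mid(a δ) → a`,
`δ·mid(b δ) → b`) and a floor point `s ≠ a` on the floor line close to `a`, `floorData` produces the
lattice floor points `s_δ → s` (vertical floor mid-edges of the row `m δ`) and, eventually along
`δ → 0⁺`, everything the bootstrap needs about them: the floor forms of `a δ`, `b δ`, `s_δ`
(`floorEdge_data`), boundary membership and non-emptiness of the walk spaces, the integer span
`n δ = ⌈2|s - a|/δ⌉` with the hypotheses of SHORT-CHORD LOCALITY at `(n δ, Λ δ, a δ, s_δ)` (the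
half-box of radius `2K n δ` lies in the rigid ball), and the inclusion of the near region in `Λ' δ`.
-/

noncomputable section

open scoped BigOperators Topology Classical
open Filter Set Metric
open Literature.Probability.LatticeModels (HexVertex hexGraph hexCenter Site)
open Literature.Probability.RandomPlanarGeometry
open Literature.Probability.RandomPlanarGeometry.SAW

namespace Summit.CriticalPhenomena.SAWScalingLimit.Theorems.ObservableToSLE.FloorRatio

/-! ### Scaled distances -/

/-- Scaling distances by the mesh: `dist (δ z) (δ w) = δ · dist z w`. [folklore] -/
theorem dist_smul_mesh {δ : ℝ} (hδ : 0 ≤ δ) (z w : ℂ) :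
    dist ((δ : ℂ) * z) ((δ : ℂ) * w) = δ * dist z w := by
  rw [dist_eq_norm, ← mul_sub, norm_mul, Complex.norm_real, Real.norm_of_nonneg hδ, ← dist_eq_norm]

/-- A lattice point at lattice distance `≤ R` from `mid e` is, after scaling, within `δ R + r` of any
point `p` with `dist (δ mid e, p) ≤ r`. [folklore] -/
theorem dist_mesh_le {δ : ℝ} (hδ : 0 ≤ δ) {z w p : ℂ} {R r : ℝ} (hz : dist z w ≤ R)
    (hw : dist ((δ : ℂ) * w) p ≤ r) : dist ((δ : ℂ) * z) p ≤ δ * R + r :=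
  calc dist ((δ : ℂ) * z) p ≤ dist ((δ : ℂ) * z) ((δ : ℂ) * w) + dist ((δ : ℂ) * w) p :=
        dist_triangle _ _ _
    _ ≤ δ * R + r := by rw [dist_smul_mesh hδ]; exact add_le_add (mul_le_mul_of_nonneg_left hz hδ) hw

/-! ### Floor form of a boundary mid-edge near a rigid marked point -/

/-- **Floor form of a boundary mid-edge in a rigid ball.**  If `e ∈ ∂Λ`, `δ · mid e` is within `ρ/2`
of `p`, `δ < ρ`, and membership in `Λ` and `Λ'` of the lattice points whose scaled centres lie in
`B(p, ρ)` is decided by the row `m`, then `e` is the vertical floor mid-edge `s_x` of a cell `x` of the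
row `m`, its inner endpoint `(x, 0)` lies in `Λ` and `Λ'` and its outer endpoint `(x - e₁, 1)` in
neither. [cite: DuminilCopinSmirnov2012, §3 (the bottom boundary α)] -/
theorem floorEdge_data {Λ Λ' : Finset HexVertex} {m : ℤ} {e : Sym2 HexVertex} {p : ℂ} {ρ δ : ℝ}
    (hδ : 0 < δ) (hδρ : δ < ρ) (he : e ∈ hexDomainBoundary Λ)
    (hdist : dist ((δ : ℂ) * hexMidpoint e) p < ρ / 2)
    (hrows : ∀ v : HexVertex, (δ : ℂ) * hexCenter v ∈ ball p ρ →
      ((v ∈ Λ ↔ m ≤ v.1 1) ∧ (v ∈ Λ' ↔ m ≤ v.1 1))) :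
    ∃ x : Site 2, x 1 = m ∧ e = s((x - Pi.single 1 1, 1), (x, 0)) ∧
      (x, (0 : Fin 2)) ∈ Λ ∧ (x, (0 : Fin 2)) ∈ Λ' ∧
      (x - Pi.single 1 1, (1 : Fin 2)) ∉ Λ ∧ (x - Pi.single 1 1, (1 : Fin 2)) ∉ Λ' := by
  have hedge : e ∈ hexGraph.edgeSet := he.1
  have hball : ∀ w ∈ e, (δ : ℂ) * hexCenter w ∈ ball p ρ := by
    intro w hw
    rw [mem_ball]
    have h := dist_mesh_le hδ.le (dist_hexCenter_hexMidpoint_le hedge hw) hdist.le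
    calc dist ((δ : ℂ) * hexCenter w) p ≤ δ * (1 / 2) + ρ / 2 := h
      _ < ρ := by linarith
  obtain ⟨x, hx1, rfl⟩ := exists_eq_floorEdge_of_rows he fun w hw => (hrows w (hball w hw)).1
  have h0 := hrows _ (hball _ (Sym2.mem_mk_right _ _))
  have h1 := hrows _ (hball _ (Sym2.mem_mk_left _ _))
  refine ⟨x, hx1, rfl, h0.1.2 (by simp [hx1]), h0.2.2 (by simp [hx1]), fun h => ?_, fun h => ?_⟩
  · have := h1.1.1 h
    simp [hx1] at this
  · have := h1.2.1 h
    simp [hx1] at this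

/-! ### The floor data of the bootstrap -/

/-- **The lattice floor data of the bootstrap.**  See the module docstring.  Hypotheses: the
admissibility clause of the mechanism stub (eventually along `δ → 0⁺`), the endpoint limits
`δ·mid(a δ) → a`, `δ·mid(b δ) → b`, a floor point `s ≠ a` with `im s = im a`,
`|s - a| < ρ/4`, and a constant `K > 0` with `8K|s - a| < ρ`.  Conclusion: lattice floor points
`s_δ → s` and an integer span `n δ ≥ 1` such that eventually `a δ = s_x`, `b δ = s_{x'}`,
`s_δ = s_y` are vertical floor mid-edges of the row `m δ` with `x' ≠ x`, `y ≠ x`, both families lie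
in the rows `≥ m δ`, `s_δ` is a boundary mid-edge of both, the three walk spaces are nonempty,
`dist(mid a δ, mid s_δ) ≤ n δ`, the floor hypotheses of short-chord locality hold at
`(n δ, Λ δ, a δ, s_δ)` with constant `K`, and the vertices of `Λ δ` closer than `K n δ` to `mid(a δ)`
lie in `Λ' δ`. [cite: DuminilCopinSmirnov2012, §3 (the bottom boundary α)] -/
theorem floorData (D D' : DobrushinDomain) (ρ : ℝ) (Λ Λ' : ℝ → Finset HexVertex) (m : ℝ → ℤ)
    (a b : ℝ → Sym2 HexVertex) (hρ : 0 < ρ)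
    (hev : ∀ᶠ δ : ℝ in 𝓝[>] 0,
      Λ' δ ⊆ Λ δ ∧ hexDomainSimplyConnected (Λ δ) ∧ hexDomainSimplyConnected (Λ' δ) ∧
      (hexGraph.induce (↑(Λ δ) : Set HexVertex)).Preconnected ∧
      (hexGraph.induce (↑(Λ' δ) : Set HexVertex)).Preconnected ∧
      a δ ∈ hexDomainBoundary (Λ δ) ∧ b δ ∈ hexDomainBoundary (Λ δ) ∧
      a δ ∈ hexDomainBoundary (Λ' δ) ∧ b δ ∈ hexDomainBoundary (Λ' δ) ∧
      Nonempty (HexMidEdgeSAW (Λ' δ) (a δ) (b δ)) ∧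
      (∀ v ∈ Λ δ, (δ : ℂ) * hexCenter v ∈ D.carrier ∧ m δ ≤ v.1 1) ∧
      (∀ v ∈ Λ' δ, (δ : ℂ) * hexCenter v ∈ D'.carrier) ∧
      (∀ v : HexVertex, (δ : ℂ) * hexCenter v ∈ ball (D.pt 0) ρ ∪ ball (D.pt 1) ρ →
        ((v ∈ Λ δ ↔ m δ ≤ v.1 1) ∧ (v ∈ Λ' δ ↔ m δ ≤ v.1 1))))
    (ha : Tendsto (fun δ : ℝ => (δ : ℂ) * hexMidpoint (a δ)) (𝓝[>] 0) (𝓝 (D.pt 0)))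
    (hb : Tendsto (fun δ : ℝ => (δ : ℂ) * hexMidpoint (b δ)) (𝓝[>] 0) (𝓝 (D.pt 1)))
    {s : ℂ} (hsa : s ≠ D.pt 0) (hsim : s.im = (D.pt 0).im) (hsρ : dist s (D.pt 0) < ρ / 4)
    {K : ℝ} (hK : 0 < K) (hKs : 8 * K * dist s (D.pt 0) < ρ) :
    ∃ (sE : ℝ → Sym2 HexVertex) (n : ℝ → ℕ),
      Tendsto (fun δ : ℝ => (δ : ℂ) * hexMidpoint (sE δ)) (𝓝[>] 0) (𝓝 s) ∧
      ∀ᶠ δ : ℝ in 𝓝[>] 0, ∃ x x' yy : Site 2,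
        x 1 = m δ ∧ x' 1 = m δ ∧ yy 1 = m δ ∧ x' ≠ x ∧ yy ≠ x ∧
        a δ = s((x - Pi.single 1 1, 1), (x, 0)) ∧ b δ = s((x' - Pi.single 1 1, 1), (x', 0)) ∧
        sE δ = s((yy - Pi.single 1 1, 1), (yy, 0)) ∧ a δ ≠ sE δ ∧
        (∀ v ∈ Λ δ, x 1 ≤ v.1 1) ∧ (∀ v ∈ Λ' δ, x 1 ≤ v.1 1) ∧
        sE δ ∈ hexDomainBoundary (Λ δ) ∧ sE δ ∈ hexDomainBoundary (Λ' δ) ∧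
        Nonempty (HexMidEdgeSAW (Λ δ) (a δ) (b δ)) ∧
        Nonempty (HexMidEdgeSAW (Λ δ) (a δ) (sE δ)) ∧
        Nonempty (HexMidEdgeSAW (Λ' δ) (a δ) (sE δ)) ∧
        1 ≤ n δ ∧ dist (hexMidpoint (a δ)) (hexMidpoint (sE δ)) ≤ n δ ∧
        (hexMidpoint (sE δ)).im = (hexMidpoint (a δ)).im ∧
        (∀ v ∈ Λ δ, (hexMidpoint (a δ)).im < (hexCenter v).im) ∧
        (∀ v : HexVertex, (hexMidpoint (a δ)).im < (hexCenter v).im →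
          dist (hexCenter v) (hexMidpoint (a δ)) ≤ 2 * K * n δ → v ∈ Λ δ) ∧
        (∀ v ∈ Λ δ, dist (hexCenter v) (hexMidpoint (a δ)) < K * n δ → v ∈ Λ' δ) := by
  set a₀ : ℂ := D.pt 0 with ha₀
  set b₀ : ℂ := D.pt 1 with hb₀
  set τ : ℝ := dist s a₀ with hτdef
  have hτ : 0 < τ := dist_pos.2 hsa
  have hab : a₀ ≠ b₀ := fun h => absurd (D.pt_injective h) (by decide)
  have hdab : 0 < dist a₀ b₀ := dist_pos.2 hab
  -- (A) floor forms of `a δ` and `b δ`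
  have hδρ : ∀ᶠ δ : ℝ in 𝓝[>] 0, δ < ρ := mem_nhdsWithin_of_mem_nhds (Iio_mem_nhds hρ)
  have hA : ∀ᶠ δ : ℝ in 𝓝[>] 0, ∃ x : Site 2, x 1 = m δ ∧ a δ = s((x - Pi.single 1 1, 1), (x, 0)) ∧
      (x, (0 : Fin 2)) ∈ Λ δ ∧ (x, (0 : Fin 2)) ∈ Λ' δ ∧
      (x - Pi.single 1 1, (1 : Fin 2)) ∉ Λ δ ∧ (x - Pi.single 1 1, (1 : Fin 2)) ∉ Λ' δ := by
    have h1 : ∀ᶠ δ : ℝ in 𝓝[>] 0, dist ((δ : ℂ) * hexMidpoint (a δ)) a₀ < ρ / 2 :=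
      Metric.tendsto_nhds.1 ha _ (half_pos hρ)
    filter_upwards [hev, h1, hδρ, self_mem_nhdsWithin] with δ hevδ h1 h2 hδ
    obtain ⟨-, -, -, -, -, haΛ, -, -, -, -, -, -, hrows⟩ := hevδ
    exact floorEdge_data hδ h2 haΛ h1 fun v hv => hrows v (Or.inl hv)
  have hB : ∀ᶠ δ : ℝ in 𝓝[>] 0, ∃ x' : Site 2, x' 1 = m δ ∧
      b δ = s((x' - Pi.single 1 1, 1), (x', 0)) := by
    have h1 : ∀ᶠ δ : ℝ in 𝓝[>] 0, dist ((δ : ℂ) * hexMidpoint (b δ)) b₀ < ρ / 2 :=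
      Metric.tendsto_nhds.1 hb _ (half_pos hρ)
    filter_upwards [hev, h1, hδρ, self_mem_nhdsWithin] with δ hevδ h1 h2 hδ
    obtain ⟨-, -, -, -, -, -, hbΛ, -, -, -, -, -, hrows⟩ := hevδ
    obtain ⟨x', hx'1, hbx, -⟩ := floorEdge_data hδ h2 hbΛ h1 fun v hv => hrows v (Or.inr hv)
    exact ⟨x', hx'1, hbx⟩
  -- (B) the row height tends to the floor height
  have him_a : Tendsto (fun δ : ℝ => δ * ((m δ : ℝ) * (Real.sqrt 3 / 2))) (𝓝[>] 0) (𝓝 a₀.im) := by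
    refine ((Complex.continuous_im.tendsto _).comp ha).congr' ?_
    filter_upwards [hA] with δ ⟨x, hx1, hax, _⟩
    simp only [Function.comp_apply, Complex.mul_im, Complex.ofReal_re, Complex.ofReal_im, zero_mul,
      add_zero]
    rw [hax, im_hexMidpoint_floorEdge, hx1]
  -- (C) the lattice floor points `s_δ` and the span `n δ`
  set y : ℝ → Site 2 := fun δ => ![round (s.re / δ - (m δ : ℝ) / 2 - 1 / 2), m δ] with hy
  have hy0 : ∀ δ, y δ 0 = round (s.re / δ - (m δ : ℝ) / 2 - 1 / 2) := fun δ => rfl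
  have hy1 : ∀ δ, y δ 1 = m δ := fun δ => rfl
  set sE : ℝ → Sym2 HexVertex := fun δ => s((y δ - Pi.single 1 1, 1), (y δ, 0)) with hsE
  set n : ℝ → ℕ := fun δ => ⌈2 * τ / δ⌉₊ with hn
  have hsE_re : ∀ δ : ℝ, 0 < δ → |δ * (hexMidpoint (sE δ)).re - s.re| ≤ δ / 2 := by
    intro δ hδ
    simp only [hsE]
    rw [re_hexMidpoint_floorEdge, hy0, hy1]
    set X : ℝ := s.re / δ - (m δ : ℝ) / 2 - 1 / 2 with hX
    have heq : δ * ((round X : ℤ) + (m δ : ℝ) / 2 + 1 / 2) - s.re = δ * ((round X : ℤ) - X) := by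
      rw [hX]; field_simp; ring
    rw [heq, abs_mul, abs_of_pos hδ, abs_sub_comm]
    have := abs_sub_round X
    nlinarith
  have hsE_lim : Tendsto (fun δ : ℝ => (δ : ℂ) * hexMidpoint (sE δ)) (𝓝[>] 0) (𝓝 s) := by
    have hre : Tendsto (fun δ : ℝ => δ * (hexMidpoint (sE δ)).re) (𝓝[>] 0) (𝓝 s.re) := by
      rw [Metric.tendsto_nhds]
      intro ε hε
      have hev1 : ∀ᶠ δ : ℝ in 𝓝[>] 0, δ < ε := mem_nhdsWithin_of_mem_nhds (Iio_mem_nhds hε)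
      filter_upwards [hev1, self_mem_nhdsWithin] with δ hδε hδ
      rw [Real.dist_eq]
      have := hsE_re δ hδ
      linarith
    have him : Tendsto (fun δ : ℝ => δ * (hexMidpoint (sE δ)).im) (𝓝[>] 0) (𝓝 s.im) := by
      rw [hsim]
      refine him_a.congr fun δ => ?_
      simp only [hsE]
      rw [im_hexMidpoint_floorEdge, hy1]
    have hfun : (fun δ : ℝ => (δ : ℂ) * hexMidpoint (sE δ)) = fun δ =>
        ((δ * (hexMidpoint (sE δ)).re : ℝ) : ℂ) + ((δ * (hexMidpoint (sE δ)).im : ℝ) : ℂ) * Complex.I := by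
      funext δ
      apply Complex.ext <;> simp
    rw [hfun, ← Complex.re_add_im s]
    exact ((Complex.continuous_ofReal.tendsto _).comp hre).add
      (((Complex.continuous_ofReal.tendsto _).comp him).mul tendsto_const_nhds)
  refine ⟨sE, n, hsE_lim, ?_⟩
  -- (D) eventual smallness
  set θ₁ : ℝ := min (τ / 4) (dist a₀ b₀ / 4) with hθ₁
  set θb : ℝ := min (ρ / 2) (dist a₀ b₀ / 4) with hθb
  have hθ₁pos : 0 < θ₁ := lt_min (by positivity) (by positivity)
  have hθbpos : 0 < θb := lt_min (by positivity) (by positivity)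
  have hθ₁τ : θ₁ ≤ τ / 4 := min_le_left _ _
  have hθ₁d : θ₁ ≤ dist a₀ b₀ / 4 := min_le_right _ _
  have hθbd : θb ≤ dist a₀ b₀ / 4 := min_le_right _ _
  have e1 : ∀ᶠ δ : ℝ in 𝓝[>] 0, dist ((δ : ℂ) * hexMidpoint (a δ)) a₀ < θ₁ :=
    Metric.tendsto_nhds.1 ha _ hθ₁pos
  have e2 : ∀ᶠ δ : ℝ in 𝓝[>] 0, dist ((δ : ℂ) * hexMidpoint (b δ)) b₀ < θb :=
    Metric.tendsto_nhds.1 hb _ hθbpos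
  have e3 : ∀ᶠ δ : ℝ in 𝓝[>] 0, dist ((δ : ℂ) * hexMidpoint (sE δ)) s < θ₁ :=
    Metric.tendsto_nhds.1 hsE_lim _ hθ₁pos
  have e4 : ∀ᶠ δ : ℝ in 𝓝[>] 0, δ < τ := mem_nhdsWithin_of_mem_nhds (Iio_mem_nhds hτ)
  have e5 : ∀ᶠ δ : ℝ in 𝓝[>] 0, δ < ρ / (8 * K) :=
    mem_nhdsWithin_of_mem_nhds (Iio_mem_nhds (by positivity))
  filter_upwards [hev, hA, hB, e1, e2, e3, e4, e5, self_mem_nhdsWithin] with δ hevδ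
    ⟨x, hx1, hax, hx0Λ, hx0Λ', hxdΛ, hxdΛ'⟩ ⟨x', hx'1, hbx⟩ e1 e2 e3 e4 e5 hδ
  obtain ⟨hsubΛ, -, -, hconn, hconn', -, -, haΛ', -, hne', hΛD, -, hrows⟩ := hevδ
  have hδ0 : (0 : ℝ) < δ := hδ
  have hτρ : τ < ρ / 4 := hsρ
  have hKτ : 8 * K * τ < ρ := hKs
  have hδK : 2 * K * δ < ρ / 4 := by
    have := (lt_div_iff₀ (by positivity : (0 : ℝ) < 8 * K)).1 e5
    linarith
  have hrowsΛ : ∀ v ∈ Λ δ, x 1 ≤ v.1 1 := fun v hv => hx1 ▸ (hΛD v hv).2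
  have hrowsΛ' : ∀ v ∈ Λ' δ, x 1 ≤ v.1 1 := fun v hv => hrowsΛ v (hsubΛ hv)
  -- the endpoints of `s_δ` lie in the rigid ball at `a₀`
  have hsEa : dist ((δ : ℂ) * hexMidpoint (sE δ)) a₀ < τ / 4 + τ := by
    calc dist ((δ : ℂ) * hexMidpoint (sE δ)) a₀
        ≤ dist ((δ : ℂ) * hexMidpoint (sE δ)) s + dist s a₀ := dist_triangle _ _ _
      _ < τ / 4 + τ := by linarith
  have hsEedge : sE δ ∈ hexGraph.edgeSet := (SimpleGraph.mem_edgeSet hexGraph).2 (adj_floorEdge (y δ))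
  have hsEball : ∀ w ∈ sE δ, (δ : ℂ) * hexCenter w ∈ ball a₀ ρ := by
    intro w hw
    rw [mem_ball]
    have h := dist_mesh_le hδ0.le (dist_hexCenter_hexMidpoint_le hsEedge hw) hsEa.le
    calc dist ((δ : ℂ) * hexCenter w) a₀ ≤ δ * (1 / 2) + (τ / 4 + τ) := h
      _ < ρ := by linarith
  have hy0Λ : (y δ, (0 : Fin 2)) ∈ Λ δ :=
    (hrows _ (Or.inl (hsEball _ (Sym2.mem_mk_right _ _)))).1.2 (le_of_eq (hy1 δ).symm)
  have hy0Λ' : (y δ, (0 : Fin 2)) ∈ Λ' δ :=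
    (hrows _ (Or.inl (hsEball _ (Sym2.mem_mk_right _ _)))).2.2 (le_of_eq (hy1 δ).symm)
  have hydΛ : (y δ - Pi.single 1 1, (1 : Fin 2)) ∉ Λ δ := fun h => by
    have := (hrows _ (Or.inl (hsEball _ (Sym2.mem_mk_left _ _)))).1.1 h
    simp [hy1] at this
  have hydΛ' : (y δ - Pi.single 1 1, (1 : Fin 2)) ∉ Λ' δ := fun h => by
    have := (hrows _ (Or.inl (hsEball _ (Sym2.mem_mk_left _ _)))).2.1 h
    simp [hy1] at this
  have hsEbd : sE δ ∈ hexDomainBoundary (Λ δ) := ⟨hsEedge, _, _, rfl, hy0Λ, hydΛ⟩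
  have hsEbd' : sE δ ∈ hexDomainBoundary (Λ' δ) := ⟨hsEedge, _, _, rfl, hy0Λ', hydΛ'⟩
  -- distances between the floor points
  have hd_as_le : dist ((δ : ℂ) * hexMidpoint (a δ)) ((δ : ℂ) * hexMidpoint (sE δ)) ≤ 2 * τ := by
    calc dist ((δ : ℂ) * hexMidpoint (a δ)) ((δ : ℂ) * hexMidpoint (sE δ))
        ≤ dist ((δ : ℂ) * hexMidpoint (a δ)) a₀ + dist a₀ ((δ : ℂ) * hexMidpoint (sE δ)) :=
          dist_triangle _ _ _
      _ ≤ θ₁ + (τ / 4 + τ) := by rw [dist_comm a₀]; linarith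
      _ ≤ 2 * τ := by linarith
  have e1' : dist a₀ ((δ : ℂ) * hexMidpoint (a δ)) < θ₁ := by rw [dist_comm]; exact e1
  have hd_as_ge : τ / 2 ≤ dist ((δ : ℂ) * hexMidpoint (a δ)) ((δ : ℂ) * hexMidpoint (sE δ)) := by
    have h := dist_triangle4 a₀ ((δ : ℂ) * hexMidpoint (a δ)) ((δ : ℂ) * hexMidpoint (sE δ)) s
    have : dist a₀ s = τ := by rw [hτdef, dist_comm]
    linarith
  have hd_ab_pos : 0 < dist ((δ : ℂ) * hexMidpoint (a δ)) ((δ : ℂ) * hexMidpoint (b δ)) := by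
    have h := dist_triangle4 a₀ ((δ : ℂ) * hexMidpoint (a δ)) ((δ : ℂ) * hexMidpoint (b δ)) b₀
    linarith
  have hyx : y δ ≠ x := by
    intro h
    have : a δ = sE δ := by rw [hax]; simp only [hsE, h]
    rw [this, dist_self] at hd_as_ge
    linarith
  have hx'x : x' ≠ x := by
    intro h
    have : a δ = b δ := by rw [hax, hbx, h]
    rw [this, dist_self] at hd_ab_pos
    exact lt_irrefl _ hd_ab_pos
  have hasE : a δ ≠ sE δ := by
    intro h; rw [h, dist_self] at hd_as_ge; linarith
  -- nonempty walk spaces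
  have hne_ab : Nonempty (HexMidEdgeSAW (Λ δ) (a δ) (b δ)) := by
    obtain ⟨ι, -, -⟩ := exists_injective_verts_eq hsubΛ (a δ) (b δ)
    exact hne'.map ι
  have hne_as : Nonempty (HexMidEdgeSAW (Λ δ) (a δ) (sE δ)) := by
    rw [hax] at hasE ⊢
    exact nonempty_hexMidEdgeSAW_of_preconnected hconn (adj_floorEdge x) hxdΛ hx0Λ hydΛ hy0Λ hasE
  have hne_as' : Nonempty (HexMidEdgeSAW (Λ' δ) (a δ) (sE δ)) := by
    rw [hax] at hasE ⊢
    exact nonempty_hexMidEdgeSAW_of_preconnected hconn' (adj_floorEdge x) hxdΛ' hx0Λ' hydΛ' hy0Λ' hasE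
  -- the span `n δ`
  have hn1 : 1 ≤ n δ := Nat.one_le_iff_ne_zero.2 (Nat.pos_iff_ne_zero.1 (Nat.ceil_pos.2 (by positivity)))
  have hnge : 2 * τ / δ ≤ (n δ : ℝ) := Nat.le_ceil _
  have hnle : (n δ : ℝ) * δ ≤ 2 * τ + δ := by
    have h := Nat.ceil_lt_add_one (show (0 : ℝ) ≤ 2 * τ / δ by positivity)
    have : (n δ : ℝ) ≤ 2 * τ / δ + 1 := h.le
    calc (n δ : ℝ) * δ ≤ (2 * τ / δ + 1) * δ := mul_le_mul_of_nonneg_right this hδ0.le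
      _ = 2 * τ + δ := by field_simp
  have hndist : dist (hexMidpoint (a δ)) (hexMidpoint (sE δ)) ≤ n δ := by
    have h : δ * dist (hexMidpoint (a δ)) (hexMidpoint (sE δ)) ≤ 2 * τ := by
      rw [← dist_smul_mesh hδ0.le]; exact hd_as_le
    calc dist (hexMidpoint (a δ)) (hexMidpoint (sE δ)) = δ * dist (hexMidpoint (a δ)) (hexMidpoint (sE δ)) / δ := by
          field_simp
      _ ≤ 2 * τ / δ := div_le_div_of_nonneg_right h hδ0.le
      _ ≤ n δ := hnge
  -- the floor hypotheses of short-chord locality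
  have himeq : (hexMidpoint (sE δ)).im = (hexMidpoint (a δ)).im := by
    rw [hax]; simp only [hsE]; rw [im_hexMidpoint_floorEdge, im_hexMidpoint_floorEdge, hy1, hx1]
  have habove : ∀ v ∈ Λ δ, (hexMidpoint (a δ)).im < (hexCenter v).im := by
    rw [hax]; exact forall_im_lt_of_rows hrowsΛ
  have hvball : ∀ v : HexVertex, dist (hexCenter v) (hexMidpoint (a δ)) ≤ 2 * K * n δ →
      (δ : ℂ) * hexCenter v ∈ ball a₀ ρ := by
    intro v hv
    rw [mem_ball]
    have h := dist_mesh_le hδ0.le hv e1.le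
    have h2 : δ * (2 * K * n δ) ≤ 2 * K * (2 * τ + δ) := by nlinarith
    calc dist ((δ : ℂ) * hexCenter v) a₀ ≤ δ * (2 * K * n δ) + θ₁ := h
      _ ≤ 2 * K * (2 * τ + δ) + τ / 4 := by linarith
      _ < ρ := by nlinarith
  have hbox : ∀ v : HexVertex, (hexMidpoint (a δ)).im < (hexCenter v).im →
      dist (hexCenter v) (hexMidpoint (a δ)) ≤ 2 * K * n δ → v ∈ Λ δ := by
    intro v hv hvd
    have hvrow : x 1 ≤ v.1 1 := by
      rw [hax] at hv
      obtain ⟨z, i⟩ := v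
      exact (im_hexMidpoint_lt_im_hexCenter_iff x z i).1 hv
    exact (hrows v (Or.inl (hvball v hvd))).1.2 (hx1 ▸ hvrow)
  have hnear : ∀ v ∈ Λ δ, dist (hexCenter v) (hexMidpoint (a δ)) < K * n δ → v ∈ Λ' δ := by
    intro v hv hvd
    have hvd' : dist (hexCenter v) (hexMidpoint (a δ)) ≤ 2 * K * n δ := by
      have : (0 : ℝ) ≤ K * n δ := by positivity
      linarith
    exact (hrows v (Or.inl (hvball v hvd'))).2.2 (hΛD v hv).2
  exact ⟨x, x', y δ, hx1, hx'1, hy1 δ, hx'x, hyx, hax, hbx, rfl, hasE, hrowsΛ, hrowsΛ', hsEbd,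
    hsEbd', hne_ab, hne_as, hne_as', hn1, hndist, himeq, habove, hbox, hnear⟩

/-! ### Registered form (sub-goal of `stub_restrictionCocycle`) -/

/-- **Registered sub-goal `stub_restrictionCocycle_floorEdgeData`** (crux item
stmt-CriticalPhenomena-10472, line `floor-ratio-restriction-bootstrap`, mechanism stub
`stub_restrictionCocycle`): the floor form of a boundary mid-edge in a rigid ball
(`floorEdge_data`). [cite: DuminilCopinSmirnov2012, §3 (the bottom boundary α)] -/
theorem stub_restrictionCocycle_floorEdgeData : ∀ (Λ Λ' : Finset HexVertex) (m : ℤ)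
    (e : Sym2 HexVertex) (p : ℂ) (ρ δ : ℝ), 0 < δ → δ < ρ → e ∈ hexDomainBoundary Λ →
    dist ((δ : ℂ) * hexMidpoint e) p < ρ / 2 →
    (∀ v : HexVertex, (δ : ℂ) * hexCenter v ∈ ball p ρ →
      ((v ∈ Λ ↔ m ≤ v.1 1) ∧ (v ∈ Λ' ↔ m ≤ v.1 1))) →
    ∃ x : Site 2, x 1 = m ∧ e = s((x - Pi.single 1 1, 1), (x, 0)) ∧
      (x, (0 : Fin 2)) ∈ Λ ∧ (x, (0 : Fin 2)) ∈ Λ' ∧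
      (x - Pi.single 1 1, (1 : Fin 2)) ∉ Λ ∧ (x - Pi.single 1 1, (1 : Fin 2)) ∉ Λ' :=
  fun _ _ _ _ _ _ _ hδ hδρ he hdist hrows => floorEdge_data hδ hδρ he hdist hrows

end Summit.CriticalPhenomena.SAWScalingLimit.Theorems.ObservableToSLE.FloorRatio

end
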